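import Literature.Probability.Percolation.ZeroOneLaw
import HarnessLib

/-!
# The zero–one law for invariant events of an asymptotically mixing transformation

Topic `Literature/Probability/Percolation`, namespace `Literature.StatMech`. `ZeroOneLaw.lean` proves
(`measure_eq_zero_or_one_of_preimage_eq`) that the invariant events of a measure-preserving `T`
are trivial as soon as every set `B` of a generating ring is *exactly* independent of some
iterate `T⁻ⁿB` — the situation of Bernoulli shifts. Dependent translation-invariant laws (Gibbs
measures, the random-current measures of Aizenman–Duminil-Copin–Sidoravicius) are only
*asymptotically* mixing: `μ(B ∩ T⁻ⁿB) → μ(B)²`. This file proves the same zero–one law under that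
weaker hypothesis (`measure_eq_zero_or_one_of_preimage_eq_of_mixing`, `ergodic_of_asymptotic_mixing`),
which is the reduction used in

* M. Aizenman, H. Duminil-Copin, V. Sidoravicius, *Random currents and continuity of Ising
  model's spontaneous magnetization*, Comm. Math. Phys. **334** (2015), proof of Thm. 2.3, R3
  (arXiv v3, p. 9): "Since every translationally invariant event can be approximated by events
  depending on a finite number of edges, it is sufficient to prove that for any events `A` and
  `B` depending on a finite number of edges, `lim_{‖x₁‖→∞} P̂[A ∩ τ_x B] = P̂[A] P̂[B]`."

(Standard: P. Walters, *An Introduction to Ergodic Theory*, Thm. 1.17 and Def. 1.5/Thm. 1.23 —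
mixing on a generating semi-algebra implies ergodicity.)

## Proof

As in `ZeroOneLaw.lean`: approximate the invariant `A` by `B ∈ C` within `ε` in measure
(`exists_measure_symmDiff_lt_of_generateFrom_isSetRing`); then for the `n` given by the mixing
hypothesis `μ(A) = μ(A ∩ T⁻ⁿA) ≈_{2ε} μ(B ∩ T⁻ⁿB) ≈_{ε} μ(B)² ≈_{2ε} μ(A)²`, so `μ(A) = μ(A)²`.
-/

noncomputable section

namespace Literature.Probability.Percolation

open MeasureTheory ProbabilityTheory
open scoped symmDiff ENNReal

variable {Ω : Type*} [mΩ : MeasurableSpace Ω] {μ : Measure Ω}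

/-- **Zero–one law for invariant events under asymptotic mixing on a generating ring**
(ADS15, proof of Thm. 2.3 R3, first reduction; Walters, Thm. 1.17): let `T` preserve the
probability measure `μ`, let the ring of sets `C` generate the σ-algebra and cover the space up to
a null set, and suppose that for every `B ∈ C` and `ε > 0` some iterate satisfies
`|μ(B ∩ T⁻ⁿB) - μ(B)²| < ε`. Then every measurable `A` with `T⁻¹A = A` has `μ(A) ∈ {0, 1}`. [cite: AizenmanDuminilCopinSidoraviciusCMP2015, Thm. 2.3 (proof of R3, p. 9)] -/
theorem measure_eq_zero_or_one_of_preimage_eq_of_mixing [IsProbabilityMeasure μ] {C : Set (Set Ω)}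
    (hC : IsSetRing C) (hcov : ∃ D : Set (Set Ω), D.Countable ∧ D ⊆ C ∧ μ (⋃₀ D)ᶜ = 0)
    (hgen : mΩ = MeasurableSpace.generateFrom C) {T : Ω → Ω} (hT : MeasurePreserving T μ μ)
    (hmix : ∀ B ∈ C, ∀ ε : ℝ, 0 < ε →
      ∃ n : ℕ, |μ.real (B ∩ T^[n] ⁻¹' B) - μ.real B * μ.real B| < ε)
    {A : Set Ω} (hA : MeasurableSet A) (hinv : T ⁻¹' A = A) :
    μ A = 0 ∨ μ A = 1 := by
  -- Step 1: `|μ(A) - μ(A)²| < 5ε` for every `ε > 0`.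
  have key : ∀ ε : ℝ, 0 < ε → |μ.real A - μ.real A * μ.real A| < 5 * ε := by
    intro ε hε
    obtain ⟨B, hBC, hBA⟩ := exists_measure_symmDiff_lt_of_generateFrom_isSetRing hC hcov hgen hA
      (ENNReal.ofReal_pos.2 hε)
    have hBm : MeasurableSet B := by
      have : MeasurableSet[MeasurableSpace.generateFrom C] B :=
        MeasurableSpace.measurableSet_generateFrom hBC
      rwa [← hgen] at this
    obtain ⟨n, hn⟩ := hmix B hBC ε hε
    have hS : MeasurePreserving T^[n] μ μ := hT.iterate n
    have hSA : T^[n] ⁻¹' A = A := Function.IsFixedPt.preimage_iterate hinv n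
    -- the approximation error `d = μ(B ∆ A) < ε`
    have hd : μ.real (B ∆ A) < ε := ENNReal.toReal_lt_of_lt_ofReal hBA
    have h1 : |μ.real A - μ.real B| ≤ μ.real (B ∆ A) := by
      rw [symmDiff_comm]
      exact abs_measureReal_sub_le_measureReal_symmDiff hA.nullMeasurableSet hBm.nullMeasurableSet
    -- `|μ(A) - μ(B ∩ T⁻ⁿB)| ≤ 2d`
    have h2 : |μ.real A - μ.real (B ∩ T^[n] ⁻¹' B)| ≤ 2 * μ.real (B ∆ A) := by
      have hpre : μ.real (T^[n] ⁻¹' (A ∆ B)) = μ.real (A ∆ B) := by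
        simp only [measureReal_def]
        rw [hS.measure_preimage (hA.symmDiff hBm).nullMeasurableSet]
      calc |μ.real A - μ.real (B ∩ T^[n] ⁻¹' B)|
          = |μ.real (A ∩ T^[n] ⁻¹' A) - μ.real (B ∩ T^[n] ⁻¹' B)| := by
            rw [hSA, Set.inter_self]
        _ ≤ μ.real ((A ∩ T^[n] ⁻¹' A) ∆ (B ∩ T^[n] ⁻¹' B)) :=
            abs_measureReal_sub_le_measureReal_symmDiff
              (hA.inter (hS.measurable hA)).nullMeasurableSet
              (hBm.inter (hS.measurable hBm)).nullMeasurableSet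
        _ ≤ μ.real ((A ∆ B) ∪ T^[n] ⁻¹' (A ∆ B)) := by
            refine measureReal_mono ?_
            intro x hx
            simp only [Set.mem_symmDiff, Set.mem_inter_iff, Set.mem_preimage, Set.mem_union] at hx ⊢
            tauto
        _ ≤ μ.real (A ∆ B) + μ.real (T^[n] ⁻¹' (A ∆ B)) := measureReal_union_le _ _
        _ = 2 * μ.real (B ∆ A) := by rw [hpre, symmDiff_comm]; ring
    have hA0 : 0 ≤ μ.real A := measureReal_nonneg
    have hA1 : μ.real A ≤ 1 := measureReal_le_one
    have hB0 : 0 ≤ μ.real B := measureReal_nonneg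
    have hB1 : μ.real B ≤ 1 := measureReal_le_one
    have h4 : |μ.real B * μ.real B - μ.real A * μ.real A| ≤ 2 * μ.real (B ∆ A) := by
      have : μ.real B * μ.real B - μ.real A * μ.real A =
          (μ.real B - μ.real A) * (μ.real B + μ.real A) := by ring
      rw [this, abs_mul, abs_sub_comm]
      calc |μ.real A - μ.real B| * |μ.real B + μ.real A| ≤ μ.real (B ∆ A) * 2 := by
            refine mul_le_mul h1 ?_ (abs_nonneg _) measureReal_nonneg
            rw [abs_le]; constructor <;> linarith
        _ = 2 * μ.real (B ∆ A) := by ring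
    calc |μ.real A - μ.real A * μ.real A|
        ≤ |μ.real A - μ.real (B ∩ T^[n] ⁻¹' B)| +
            |μ.real (B ∩ T^[n] ⁻¹' B) - μ.real A * μ.real A| := abs_sub_le _ _ _
      _ ≤ 4 * μ.real (B ∆ A) + ε := by
          have h5 : |μ.real (B ∩ T^[n] ⁻¹' B) - μ.real A * μ.real A| ≤
              |μ.real (B ∩ T^[n] ⁻¹' B) - μ.real B * μ.real B| +
                |μ.real B * μ.real B - μ.real A * μ.real A| := abs_sub_le _ _ _
          linarith [hn.le]
      _ < 5 * ε := by linarith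
  -- Step 2: hence `μ(A) = μ(A)²`, i.e. `μ(A) ∈ {0, 1}`.
  have ha : μ.real A - μ.real A * μ.real A = 0 := by
    by_contra hne
    have hpos : 0 < |μ.real A - μ.real A * μ.real A| := abs_pos.2 hne
    have := key (|μ.real A - μ.real A * μ.real A| / 5) (by positivity)
    linarith
  have hreal : μ.real A = 0 ∨ μ.real A = 1 := by
    have : μ.real A * (1 - μ.real A) = 0 := by rw [← ha]; ring
    rcases mul_eq_zero.1 this with h | h
    · exact Or.inl h
    · exact Or.inr (by linarith)
  rcases hreal with h | h
  · exact Or.inl ((measureReal_eq_zero_iff (measure_ne_top μ A)).1 h)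
  · right
    rw [measureReal_def] at h
    exact (ENNReal.toReal_eq_one_iff _).1 h

/-- A `Tendsto` formulation of the mixing hypothesis. [folklore] -/
theorem exists_abs_sub_lt_of_tendsto_mixing {T : Ω → Ω} {B : Set Ω}
    (h : Filter.Tendsto (fun n : ℕ => μ.real (B ∩ T^[n] ⁻¹' B)) Filter.atTop
      (nhds (μ.real B * μ.real B))) (ε : ℝ) (hε : 0 < ε) :
    ∃ n : ℕ, |μ.real (B ∩ T^[n] ⁻¹' B) - μ.real B * μ.real B| < ε := by
  have h' := (Metric.tendsto_atTop.1 h) ε hε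
  obtain ⟨N, hN⟩ := h'
  exact ⟨N, by simpa [Real.dist_eq] using hN N le_rfl⟩

/-- **Asymptotic mixing on a generating ring implies ergodicity** (bundled form: `T` is
`Ergodic` for `μ`; Walters, Thm. 1.17; the reduction in ADS15, proof of Thm. 2.3 R3). [cite: AizenmanDuminilCopinSidoraviciusCMP2015, Thm. 2.3 (proof of R3, p. 9)] -/
theorem ergodic_of_asymptotic_mixing [IsProbabilityMeasure μ] {C : Set (Set Ω)}
    (hC : IsSetRing C) (hcov : ∃ D : Set (Set Ω), D.Countable ∧ D ⊆ C ∧ μ (⋃₀ D)ᶜ = 0)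
    (hgen : mΩ = MeasurableSpace.generateFrom C) {T : Ω → Ω} (hT : MeasurePreserving T μ μ)
    (hmix : ∀ B ∈ C, Filter.Tendsto (fun n : ℕ => μ.real (B ∩ T^[n] ⁻¹' B)) Filter.atTop
      (nhds (μ.real B * μ.real B))) : Ergodic T μ :=
  ⟨hT, preErgodic_of_prob_eq_zero_or_one fun _ hA hinv =>
    measure_eq_zero_or_one_of_preimage_eq_of_mixing hC hcov hgen hT
      (fun B hB => exists_abs_sub_lt_of_tendsto_mixing (hmix B hB)) hA hinv⟩

end Literature.Probability.Percolation
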